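import Mathlib
import HarnessLib
import Summits.ValiantsHypothesis.ValiantsHypothesis.Theorems.LacunarySymmetroidMatrixDescartesProductPlusOneSharpCalculus
import Summits.ValiantsHypothesis.ValiantsHypothesis.Theorems.LacunarySymmetroidMatrixDescartesProductPlusOneEulerRolle

/-!
# ValiantsHypothesis / LacunarySymmetroid — crux `MatrixDescartes` (stmt-ValiantsHypothesis-18050, V1),
# LINE (A) «product_plus_one», research stub `stub_classRowK3`: the SHARP SECTOR of the `K = 3` row is LINEAR in `m`
# — EVERY support, EVERY coupling

`sharp_sector_pos_roots`: for `m` trinomials `g_j = a_j + b_j X^{e+1} + c_j X^{e+k+2}` with `a_j, c_j > 0` each taking a negative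
value on `(0,∞)` (so each has exactly two positive zeros — the Descartes-SHARP factors, the card's «Rolle-floor seeds»), every `N` and
every real `κ`: `Z₊(κ X^N + ∏_j g_j) ≤ 4m + 2`, uniformly in `e`, `k` (ANY lacunary support) and in the coupling exponent `N`
(bottom, middle, top or anything).  Mechanism (`…SharpCalculus.logWronskian_neg`): the logarithmic derivative `φ_j = x g_j′/g_j` of a
sharp factor is strictly decreasing on each zero-free interval, hence so is `Φ = Σ_j φ_j − N`; zeros of `X·h′ − N·h = P·Φ`
(`…EulerRolle`) separate the zeros of the member `h` (Rolle for `θ_N`), so each of the `≤ 2m+1` zero-free components carries at most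
two zeros of `h`.  `sharp_sector_class`: the line's member shape `C c * X ^ (m * d l₀) + ∏ j, Σ_l C (a j l) * X ^ (d l)` with
`d 0 < d 1 < d 2`, ANY `l₀ : Fin 3`, `0 < a j 0`, `0 < a j 2` and a negativity witness per factor.  This is val-v1x-eng-10's
«all-sharp ⇒ linear» (ppo-note.md, Lemma 2 / Corollary) for `K = 3`, kernel-checked with the explicit certificate of
`…SharpCalculus`; the companion no-dip sector is `…TameSector` (ratio ≤ 4).

HONEST FRAMING: a SECTOR of the `K = 3` row; NOT `stub_classRowK3` (one-zero factors with ratio > 4, zero-free «strict dip» and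
one-signed factors, and MIXED members are not covered), not `stub_polyLaw`, not `ProductPlusOneMDR`, not `MatrixDescartes`, not
Conjecture B; `VP ≠ VNP` is NOT proved.  No definitions, no named facts; Mathlib + the lane files.
-/

-- `Summit.ValiantsHypothesis.ValiantsHypothesis.…` is the tree's mandated single-conjunct layout (Sub = Summit).
set_option linter.dupNamespace false

namespace Summit.ValiantsHypothesis.ValiantsHypothesis.Theorems.LacunarySymmetroidMatrixDescartes

namespace ProductPlusOne

open Polynomial Finset
open scoped BigOperators

/-! ### The logarithmic derivative `φ_j = x g_j′ / g_j` and `Φ = Σ_j φ_j` -/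

/-- `HasDerivAt` of `φ(y) = ((e+1) b y^{e+1} + (e+k+2) c y^{e+k+2}) / (a + b y^{e+1} + c y^{e+k+2})` off the zeros; the derivative
numerator is `x^e · (a b (e+1)² + a c (e+k+2)² x^{k+1} + b c (k+1)² x^{e+k+2})`. [folklore] -/
theorem hasDerivAt_phi (a b c : ℝ) (e k : ℕ) {x : ℝ} (hg : a + b * x ^ (e + 1) + c * x ^ (e + k + 2) ≠ 0) :
    HasDerivAt (fun y : ℝ => (((e : ℝ) + 1) * b * y ^ (e + 1) + ((e : ℝ) + k + 2) * c * y ^ (e + k + 2))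
        / (a + b * y ^ (e + 1) + c * y ^ (e + k + 2)))
      ((x ^ e * (a * b * ((e : ℝ) + 1) ^ 2 + a * c * ((e : ℝ) + k + 2) ^ 2 * x ^ (k + 1)
          + b * c * ((k : ℝ) + 1) ^ 2 * x ^ (e + k + 2)))
        / (a + b * x ^ (e + 1) + c * x ^ (e + k + 2)) ^ 2) x := by
  have hnum : HasDerivAt (fun y : ℝ => ((e : ℝ) + 1) * b * y ^ (e + 1) + ((e : ℝ) + k + 2) * c * y ^ (e + k + 2))
      (((e : ℝ) + 1) * b * (((e + 1 : ℕ) : ℝ) * x ^ e) + ((e : ℝ) + k + 2) * c * (((e + k + 2 : ℕ) : ℝ) * x ^ (e + k + 1))) x := by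
    have h1 := (hasDerivAt_pow (e + 1) x).const_mul (((e : ℝ) + 1) * b)
    have h2 := (hasDerivAt_pow (e + k + 2) x).const_mul (((e : ℝ) + k + 2) * c)
    exact h1.add h2
  have hden : HasDerivAt (fun y : ℝ => a + b * y ^ (e + 1) + c * y ^ (e + k + 2))
      (b * (((e + 1 : ℕ) : ℝ) * x ^ e) + c * (((e + k + 2 : ℕ) : ℝ) * x ^ (e + k + 1))) x := by
    have h1 := ((hasDerivAt_pow (e + 1) x).const_mul b).const_add a
    have h2 := (hasDerivAt_pow (e + k + 2) x).const_mul c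
    exact (h1.add h2).congr_deriv (by push_cast; ring)
  refine (hnum.div hden hg).congr_deriv ?_
  push_cast
  congr 1
  ring

/-- **`Φ′ < 0`** on the sharp sector: at every `x > 0` where no factor vanishes, `Φ = Σ_j φ_j` has a NEGATIVE derivative (`m ≥ 1`).
[this file's theorem] -/
theorem hasDerivAt_phisum_neg {m : ℕ} (hm : 0 < m) (a b c : Fin m → ℝ) (e k : ℕ)
    (hpos : ∀ j, 0 < a j ∧ 0 < c j) (hwit : ∀ j, ∃ x₀ : ℝ, 0 < x₀ ∧ a j + b j * x₀ ^ (e + 1) + c j * x₀ ^ (e + k + 2) < 0)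
    {x : ℝ} (hx : 0 < x) (hg : ∀ j, a j + b j * x ^ (e + 1) + c j * x ^ (e + k + 2) ≠ 0) :
    ∃ D : ℝ, D < 0 ∧ HasDerivAt (fun y : ℝ => ∑ j, (((e : ℝ) + 1) * b j * y ^ (e + 1) + ((e : ℝ) + k + 2) * c j * y ^ (e + k + 2))
        / (a j + b j * y ^ (e + 1) + c j * y ^ (e + k + 2))) D x := by
  refine ⟨∑ j, (x ^ e * (a j * b j * ((e : ℝ) + 1) ^ 2 + a j * c j * ((e : ℝ) + k + 2) ^ 2 * x ^ (k + 1)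
          + b j * c j * ((k : ℝ) + 1) ^ 2 * x ^ (e + k + 2)))
        / (a j + b j * x ^ (e + 1) + c j * x ^ (e + k + 2)) ^ 2, ?_, ?_⟩
  · refine Finset.sum_neg (fun j _ => ?_) ⟨⟨0, hm⟩, Finset.mem_univ _⟩
    obtain ⟨x₀, hx₀, hneg⟩ := hwit j
    have hW := logWronskian_neg (a j) (b j) (c j) x₀ e k (hpos j).1 (hpos j).2 hx₀ hneg hx
    have hnum : x ^ e * (a j * b j * ((e : ℝ) + 1) ^ 2 + a j * c j * ((e : ℝ) + k + 2) ^ 2 * x ^ (k + 1)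
          + b j * c j * ((k : ℝ) + 1) ^ 2 * x ^ (e + k + 2)) < 0 :=
      mul_neg_of_pos_of_neg (pow_pos hx e) hW
    exact div_neg_of_neg_of_pos hnum (by have h0 := hg j; positivity)
  · exact HasDerivAt.fun_sum (u := Finset.univ) (fun j _ => hasDerivAt_phi (a j) (b j) (c j) e k (hg j))

/-- Rolle for `Φ`: on the sharp sector `Φ` cannot take the same value at two points of a zero-free interval (`m ≥ 1`).
[this file's lemma] -/
theorem phisum_injective {m : ℕ} (hm : 0 < m) (a b c : Fin m → ℝ) (e k : ℕ)
    (hpos : ∀ j, 0 < a j ∧ 0 < c j) (hwit : ∀ j, ∃ x₀ : ℝ, 0 < x₀ ∧ a j + b j * x₀ ^ (e + 1) + c j * x₀ ^ (e + k + 2) < 0)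
    {w₁ w₂ : ℝ} (hw₁ : 0 < w₁) (hw : w₁ < w₂)
    (hfree : ∀ t ∈ Set.Icc w₁ w₂, ∀ j, a j + b j * t ^ (e + 1) + c j * t ^ (e + k + 2) ≠ 0)
    (heq : (∑ j, (((e : ℝ) + 1) * b j * w₁ ^ (e + 1) + ((e : ℝ) + k + 2) * c j * w₁ ^ (e + k + 2))
        / (a j + b j * w₁ ^ (e + 1) + c j * w₁ ^ (e + k + 2)))
      = ∑ j, (((e : ℝ) + 1) * b j * w₂ ^ (e + 1) + ((e : ℝ) + k + 2) * c j * w₂ ^ (e + k + 2))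
        / (a j + b j * w₂ ^ (e + 1) + c j * w₂ ^ (e + k + 2))) : False := by
  have hcont : ContinuousOn (fun y : ℝ => ∑ j, (((e : ℝ) + 1) * b j * y ^ (e + 1) + ((e : ℝ) + k + 2) * c j * y ^ (e + k + 2))
      / (a j + b j * y ^ (e + 1) + c j * y ^ (e + k + 2))) (Set.Icc w₁ w₂) := by
    intro t ht
    obtain ⟨D, _, hD⟩ := hasDerivAt_phisum_neg hm a b c e k hpos hwit (hw₁.trans_le ht.1) (hfree t ht)
    exact hD.continuousAt.continuousWithinAt
  obtain ⟨ξ, hξ, hξ'⟩ := exists_deriv_eq_zero hw hcont heq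
  obtain ⟨D, hDneg, hD⟩ := hasDerivAt_phisum_neg hm a b c e k hpos hwit (hw₁.trans hξ.1) (hfree ξ ⟨hξ.1.le, hξ.2.le⟩)
  rw [hD.deriv] at hξ'
  exact hDneg.ne hξ'

/-! ### Factors and the product -/

/-- A factor with positive extreme coefficients is a nonzero polynomial. [folklore] -/
theorem trinomial_ne_zero_of_pos (a b c : ℝ) (e k : ℕ) (ha : 0 < a) :
    (C a + C b * X ^ (e + 1) + C c * X ^ (e + k + 2) : ℝ[X]) ≠ 0 := by
  intro h
  have h0 := congrArg (fun p : ℝ[X] => p.coeff 0) h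
  simp only [coeff_trinomial, coeff_zero, if_true] at h0
  rw [if_neg (by omega), if_neg (by omega), add_zero, add_zero] at h0
  exact ha.ne' h0

/-- **A factor with positive extreme coefficients has at most two positive zeros** (Descartes: one negative coefficient). [folklore] -/
theorem trinomial_pos_roots_le_two (a b c : ℝ) (e k : ℕ) (ha : 0 < a) (hc : 0 < c) :
    ((C a + C b * X ^ (e + 1) + C c * X ^ (e + k + 2) : ℝ[X]).roots.toFinset.filter (fun t => 0 < t)).card ≤ 2 := by
  refine (StubVLawTwo.card_filter_pos_le_countP _).trans
    (countP_pos_roots_le_two_of_coeff_nonneg_off _ (e + 1) (fun i hi => ?_))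
  rw [coeff_trinomial, if_neg hi]
  split_ifs <;> linarith

/-- The product of the factors is nonzero. [folklore] -/
theorem prod_trinomial_ne_zero_of_pos {m : ℕ} (a b c : Fin m → ℝ) (e k : ℕ) (hpos : ∀ j, 0 < a j ∧ 0 < c j) :
    (∏ j, (C (a j) + C (b j) * X ^ (e + 1) + C (c j) * X ^ (e + k + 2)) : ℝ[X]) ≠ 0 :=
  Finset.prod_ne_zero_iff.mpr (fun j _ => trinomial_ne_zero_of_pos _ _ _ e k (hpos j).1)

/-- **The product has at most `2m` positive zeros.** [folklore] -/
theorem prod_trinomial_pos_roots_le_two_mul {m : ℕ} (a b c : Fin m → ℝ) (e k : ℕ) (hpos : ∀ j, 0 < a j ∧ 0 < c j) :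
    ((∏ j, (C (a j) + C (b j) * X ^ (e + 1) + C (c j) * X ^ (e + k + 2)) : ℝ[X]).roots.toFinset.filter
      (fun t => 0 < t)).card ≤ 2 * m := by
  classical
  have hsub : ((∏ j, (C (a j) + C (b j) * X ^ (e + 1) + C (c j) * X ^ (e + k + 2)) : ℝ[X]).roots.toFinset.filter
      (fun t => 0 < t)) ⊆ Finset.univ.biUnion (fun j =>
        ((C (a j) + C (b j) * X ^ (e + 1) + C (c j) * X ^ (e + k + 2) : ℝ[X]).roots.toFinset.filter (fun t => 0 < t))) := by
    intro x hx
    rw [mem_filter, Multiset.mem_toFinset, mem_roots (prod_trinomial_ne_zero_of_pos a b c e k hpos), IsRoot.def,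
      eval_prod, Finset.prod_eq_zero_iff] at hx
    obtain ⟨⟨j, _, hj⟩, hx0⟩ := hx
    rw [mem_biUnion]
    refine ⟨j, mem_univ _, ?_⟩
    rw [mem_filter, Multiset.mem_toFinset, mem_roots (trinomial_ne_zero_of_pos _ _ _ e k (hpos j).1), IsRoot.def]
    exact ⟨hj, hx0⟩
  refine (card_le_card hsub).trans (card_biUnion_le.trans ?_)
  calc ∑ j, (((C (a j) + C (b j) * X ^ (e + 1) + C (c j) * X ^ (e + k + 2) : ℝ[X]).roots.toFinset.filter
          (fun t => 0 < t))).card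
      ≤ ∑ _j : Fin m, 2 := Finset.sum_le_sum (fun j _ => trinomial_pos_roots_le_two _ _ _ e k (hpos j).1 (hpos j).2)
    _ = 2 * m := by simp [mul_comm]

/-- **`x·P′(x) = P(x)·Φ(x)` off the zeros** (logarithmic derivative of the product, `θ = x·d/dx`). [folklore] -/
theorem eval_euler_prod {m : ℕ} (a b c : Fin m → ℝ) (e k : ℕ) {w : ℝ}
    (hg : ∀ j, a j + b j * w ^ (e + 1) + c j * w ^ (e + k + 2) ≠ 0) :
    w * eval w (derivative (∏ j, (C (a j) + C (b j) * X ^ (e + 1) + C (c j) * X ^ (e + k + 2))))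
      = (∏ j, (a j + b j * w ^ (e + 1) + c j * w ^ (e + k + 2)))
        * ∑ j, (((e : ℝ) + 1) * b j * w ^ (e + 1) + ((e : ℝ) + k + 2) * c j * w ^ (e + k + 2))
            / (a j + b j * w ^ (e + 1) + c j * w ^ (e + k + 2)) := by
  rw [eval_derivative_prod a b c e k hg]
  have hS : (∑ j, (((e : ℝ) + 1) * b j * w ^ (e + 1) + ((e : ℝ) + k + 2) * c j * w ^ (e + k + 2))
        / (a j + b j * w ^ (e + 1) + c j * w ^ (e + k + 2)))
      = w ^ (e + 1) * ∑ j, (((e : ℝ) + 1) * b j + ((e : ℝ) + k + 2) * c j * w ^ (k + 1))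
        / (a j + b j * w ^ (e + 1) + c j * w ^ (e + k + 2)) := by
    rw [Finset.mul_sum]
    refine Finset.sum_congr rfl (fun j _ => ?_)
    rw [div_eq_mul_inv, div_eq_mul_inv]
    ring
  rw [hS]
  ring

/-! ### The count -/

/-- **THE SHARP SECTOR IS LINEAR**: `Z₊(κ X^N + ∏_j g_j) ≤ 4m + 2` for trinomials `g_j = a_j + b_j X^{e+1} + c_j X^{e+k+2}` with
`a_j, c_j > 0`, each negative somewhere on `(0,∞)`; every `e`, `k`, `N`, `κ`, `m`. [this file's theorem] -/
theorem sharp_sector_pos_roots {m : ℕ} (a b c : Fin m → ℝ) (e k : ℕ) (hpos : ∀ j, 0 < a j ∧ 0 < c j)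
    (hwit : ∀ j, ∃ x₀ : ℝ, 0 < x₀ ∧ a j + b j * x₀ ^ (e + 1) + c j * x₀ ^ (e + k + 2) < 0) (N : ℕ) (κ : ℝ) :
    ((C κ * X ^ N + ∏ j, (C (a j) + C (b j) * X ^ (e + 1) + C (c j) * X ^ (e + k + 2))).roots.toFinset.filter
      (fun t => 0 < t)).card ≤ 4 * m + 2 := by
  classical
  set P : ℝ[X] := ∏ j, (C (a j) + C (b j) * X ^ (e + 1) + C (c j) * X ^ (e + k + 2)) with hPdef
  rcases Nat.eq_zero_or_pos m with hm | hm
  · subst hm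
    have hP1 : P = 1 := by rw [hPdef]; exact Fintype.prod_empty _
    rw [hP1]
    -- `κ X^N + 1` has at most one... we only need ≤ 2: it is a member with one possibly negative coefficient
    have h2 := countP_pos_roots_le_two_of_coeff_nonneg_off (C κ * X ^ N + 1 : ℝ[X]) N (fun i hi => by
      rw [coeff_add, coeff_C_mul_X_pow, if_neg hi, zero_add, coeff_one]
      split_ifs <;> norm_num)
    exact ((StubVLawTwo.card_filter_pos_le_countP _).trans h2).trans (by omega)
  have hP0 : P ≠ 0 := prod_trinomial_ne_zero_of_pos a b c e k hpos
  by_cases hκ : κ = 0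
  · subst hκ
    rw [map_zero, zero_mul, zero_add]
    exact (prod_trinomial_pos_roots_le_two_mul a b c e k hpos).trans (by omega)
  set S := (C κ * X ^ N + P).roots.toFinset.filter (fun t => 0 < t) with hSdef
  set Zp := P.roots.toFinset.filter (fun t => 0 < t) with hZp
  have hZcard : Zp.card ≤ 2 * m := prod_trinomial_pos_roots_le_two_mul a b c e k hpos
  have hSmem : ∀ z ∈ S, 0 < z ∧ eval z (C κ * X ^ N + P) = 0 := by
    intro z hz
    rw [hSdef, mem_filter, Multiset.mem_toFinset] at hz
    by_cases h0 : C κ * X ^ N + P = 0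
    · rw [h0, roots_zero] at hz
      exact absurd hz.1 (Multiset.notMem_zero _)
    · exact ⟨hz.2, (IsRoot.def).mp ((mem_roots h0).mp hz.1)⟩
  have hPne : ∀ z ∈ S, eval z P ≠ 0 := by
    intro z hz hPz
    have h := (hSmem z hz).2
    rw [eval_add, eval_mul, eval_C, eval_pow, eval_X, hPz, add_zero] at h
    rcases mul_eq_zero.mp h with h1 | h1
    · exact hκ h1
    · exact absurd h1 (pow_ne_zero _ (hSmem z hz).1.ne')
  have hfree : ∀ z₁ ∈ S, ∀ z₃ ∈ S, z₁ < z₃ →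
      (Zp.filter (fun t => t < z₁)).card = (Zp.filter (fun t => t < z₃)).card →
      ∀ t ∈ Set.Icc z₁ z₃, ∀ j, a j + b j * t ^ (e + 1) + c j * t ^ (e + k + 2) ≠ 0 := by
    intro z₁ hz₁ z₃ hz₃ h13 hk13 t ht j hj
    have ht0 : 0 < t := (hSmem z₁ hz₁).1.trans_le ht.1
    have hPt : eval t P = 0 := by
      rw [hPdef, eval_prod, Finset.prod_eq_zero_iff]
      exact ⟨j, mem_univ _, by rw [eval_trinomial]; exact hj⟩
    rcases eq_or_lt_of_le ht.2 with h | h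
    · exact hPne z₃ hz₃ (h ▸ hPt)
    · have htZ : t ∈ Zp := by
        rw [hZp, mem_filter, Multiset.mem_toFinset, mem_roots hP0]
        exact ⟨hPt, ht0⟩
      have hsub : Zp.filter (fun s => s < z₁) ⊆ Zp.filter (fun s => s < z₃) := by
        intro s hs
        rw [mem_filter] at hs ⊢
        exact ⟨hs.1, hs.2.trans h13⟩
      have hstrict : Zp.filter (fun s => s < z₁) ⊂ Zp.filter (fun s => s < z₃) := by
        refine Finset.ssubset_iff_subset_ne.mpr ⟨hsub, fun heq => ?_⟩
        have ht1 : t ∈ Zp.filter (fun s => s < z₁) := by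
          rw [heq, mem_filter]
          exact ⟨htZ, h⟩
        rw [mem_filter] at ht1
        exact absurd ht1.2 (not_lt.mpr ht.1)
      exact absurd hk13 (Finset.card_lt_card hstrict).ne
  -- a zero of `X·h′ − N·h` in a zero-free region is a point where `Φ = N`
  have hΦ : ∀ w : ℝ, 0 < w → (∀ j, a j + b j * w ^ (e + 1) + c j * w ^ (e + k + 2) ≠ 0) →
      eval w (X * derivative (C κ * X ^ N + P) - C (N : ℝ) * (C κ * X ^ N + P)) = 0 →
      (∑ j, (((e : ℝ) + 1) * b j * w ^ (e + 1) + ((e : ℝ) + k + 2) * c j * w ^ (e + k + 2))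
          / (a j + b j * w ^ (e + 1) + c j * w ^ (e + k + 2))) = N := by
    intro w hw hg hd
    have hE : X * derivative (C κ * X ^ N + P) - C (N : ℝ) * (C κ * X ^ N + P)
        = X * derivative P - C (N : ℝ) * P := by
      have h := euler_sub_monomial P (-κ) N
      rw [map_neg] at h
      rw [show C κ * X ^ N + P = P - -C κ * X ^ N by ring]
      exact h
    rw [hE, eval_sub, eval_mul, eval_X, eval_mul, eval_C, hPdef, eval_euler_prod a b c e k hg,
      eval_prod_trinomial] at hd
    have hPw : (∏ j, (a j + b j * w ^ (e + 1) + c j * w ^ (e + k + 2))) ≠ 0 :=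
      Finset.prod_ne_zero_iff.mpr (fun j _ => hg j)
    have : (∏ j, (a j + b j * w ^ (e + 1) + c j * w ^ (e + k + 2))) *
        ((∑ j, (((e : ℝ) + 1) * b j * w ^ (e + 1) + ((e : ℝ) + k + 2) * c j * w ^ (e + k + 2))
          / (a j + b j * w ^ (e + 1) + c j * w ^ (e + k + 2))) - N) = 0 := by
      rw [mul_sub]; linarith
    rcases mul_eq_zero.mp this with h1 | h1
    · exact absurd h1 hPw
    · linarith
  have hfiber : ∀ v ∈ S.image (fun z => (Zp.filter (fun t => t < z)).card),
      (S.filter (fun z => (Zp.filter (fun t => t < z)).card = v)).card ≤ 2 := by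
    intro v _
    by_contra hcon
    push Not at hcon
    set F := S.filter (fun z => (Zp.filter (fun t => t < z)).card = v) with hF
    have hFS : ∀ z ∈ F, z ∈ S ∧ (Zp.filter (fun t => t < z)).card = v := by
      intro z hz
      rw [hF, mem_filter] at hz
      exact hz
    have hne : F.Nonempty := Finset.card_pos.mp (by omega)
    have hz₁F : F.min' hne ∈ F := Finset.min'_mem F hne
    have hF₁card : 2 ≤ (F.erase (F.min' hne)).card := by
      rw [Finset.card_erase_of_mem hz₁F]
      omega
    have hne₁ : (F.erase (F.min' hne)).Nonempty := Finset.card_pos.mp (by omega)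
    have hz₂F₁ : (F.erase (F.min' hne)).min' hne₁ ∈ F.erase (F.min' hne) := Finset.min'_mem _ hne₁
    have hne₂ : ((F.erase (F.min' hne)).erase ((F.erase (F.min' hne)).min' hne₁)).Nonempty :=
      Finset.card_pos.mp (by rw [Finset.card_erase_of_mem hz₂F₁]; omega)
    obtain ⟨z₃, hz₃F₂⟩ := hne₂
    set z₁ := F.min' hne with hz₁
    set z₂ := (F.erase z₁).min' hne₁ with hz₂
    have hz₂F : z₂ ∈ F := Finset.mem_of_mem_erase hz₂F₁
    have hz₃F₁ : z₃ ∈ F.erase z₁ := Finset.mem_of_mem_erase hz₃F₂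
    have hz₃F : z₃ ∈ F := Finset.mem_of_mem_erase hz₃F₁
    have h12 : z₁ < z₂ :=
      lt_of_le_of_ne (Finset.min'_le F z₂ hz₂F) (Finset.ne_of_mem_erase hz₂F₁).symm
    have h23 : z₂ < z₃ :=
      lt_of_le_of_ne (Finset.min'_le _ z₃ hz₃F₁) (Finset.ne_of_mem_erase hz₃F₂).symm
    obtain ⟨hz₁S, hk₁⟩ := hFS z₁ hz₁F
    obtain ⟨hz₂S, _⟩ := hFS z₂ hz₂F
    obtain ⟨hz₃S, hk₃⟩ := hFS z₃ hz₃F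
    have free13 := hfree z₁ hz₁S z₃ hz₃S (h12.trans h23) (hk₁.trans hk₃.symm)
    have hz₁pos : 0 < z₁ := (hSmem z₁ hz₁S).1
    obtain ⟨w₁, hw₁, hd₁⟩ := exists_root_euler_between (C κ * X ^ N + P) N hz₁pos h12 (hSmem z₁ hz₁S).2 (hSmem z₂ hz₂S).2
    obtain ⟨w₂, hw₂, hd₂⟩ := exists_root_euler_between (C κ * X ^ N + P) N (hz₁pos.trans h12) h23
      (hSmem z₂ hz₂S).2 (hSmem z₃ hz₃S).2
    have hw₁pos : 0 < w₁ := hz₁pos.trans hw₁.1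
    have hw₁₂ : w₁ < w₂ := hw₁.2.trans hw₂.1
    have hIcc : Set.Icc w₁ w₂ ⊆ Set.Icc z₁ z₃ :=
      fun t ht => ⟨hw₁.1.le.trans ht.1, ht.2.trans hw₂.2.le⟩
    have hg₁ := free13 w₁ (hIcc ⟨le_rfl, hw₁₂.le⟩)
    have hg₂ := free13 w₂ (hIcc ⟨hw₁₂.le, le_rfl⟩)
    have hΦ₁ := hΦ w₁ hw₁pos hg₁ hd₁
    have hΦ₂ := hΦ w₂ (hw₁pos.trans hw₁₂) hg₂ hd₂
    exact phisum_injective hm a b c e k hpos hwit hw₁pos hw₁₂ (fun t ht => free13 t (hIcc ht)) (hΦ₁.trans hΦ₂.symm)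
  have himg : S.image (fun z => (Zp.filter (fun t => t < z)).card) ⊆ Finset.range (2 * m + 1) := by
    intro v hv
    rw [Finset.mem_image] at hv
    obtain ⟨z, _, rfl⟩ := hv
    rw [Finset.mem_range]
    exact Nat.lt_succ_of_le ((Finset.card_filter_le _ _).trans hZcard)
  calc S.card = ∑ v ∈ S.image (fun z => (Zp.filter (fun t => t < z)).card),
        (S.filter (fun z => (Zp.filter (fun t => t < z)).card = v)).card :=
        Finset.card_eq_sum_card_image _ S
    _ ≤ ∑ _v ∈ S.image (fun z => (Zp.filter (fun t => t < z)).card), 2 := Finset.sum_le_sum hfiber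
    _ = 2 * (S.image (fun z => (Zp.filter (fun t => t < z)).card)).card := by
        rw [Finset.sum_const, smul_eq_mul, mul_comm]
    _ ≤ 2 * (2 * m + 1) :=
        Nat.mul_le_mul_left 2 ((Finset.card_le_card himg).trans (by rw [Finset.card_range]))
    _ = 4 * m + 2 := by ring

/-- **THE SHARP SECTOR OF THE `K = 3` ROW, line shape, ANY COUPLING** (`C c * X ^ (m * d l₀) + ∏ j, fewnomial d (a j)` unfolded
verbatim): for supports `d 0 < d 1 < d 2` (any ratio), ANY coupled letter `l₀`, and factors with `0 < a j 0`, `0 < a j 2` each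
taking a negative value on `(0,∞)`, every member has at most `4m + 2` positive zeros. [this file's theorem] -/
theorem sharp_sector_class {m : ℕ} (d : Fin 3 → ℕ) (h01 : d 0 < d 1) (h12 : d 1 < d 2) (l₀ : Fin 3)
    (a : Fin m → Fin 3 → ℝ) (hpos : ∀ j, 0 < a j 0 ∧ 0 < a j 2)
    (hwit : ∀ j, ∃ x₀ : ℝ, 0 < x₀ ∧ a j 0 * x₀ ^ (d 0) + a j 1 * x₀ ^ (d 1) + a j 2 * x₀ ^ (d 2) < 0) (c : ℝ) :
    ((C c * X ^ (m * d l₀) + ∏ j, ∑ l, C (a j l) * X ^ (d l) : ℝ[X]).roots.toFinset.filter (fun t => 0 < t)).card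
      ≤ 4 * m + 2 := by
  classical
  obtain ⟨e, he⟩ : ∃ e, d 1 = d 0 + e + 1 := ⟨d 1 - d 0 - 1, by omega⟩
  obtain ⟨k, hk⟩ : ∃ k, d 2 = d 0 + e + k + 2 := ⟨d 2 - d 1 - 1, by omega⟩
  have hl₀ : d 0 ≤ d l₀ := by fin_cases l₀ <;> simp <;> omega
  obtain ⟨N, hN⟩ : ∃ N, d l₀ = d 0 + N := ⟨d l₀ - d 0, by omega⟩
  have hfac : ∀ j, (∑ l, C (a j l) * X ^ (d l) : ℝ[X])
      = X ^ (d 0) * (C (a j 0) + C (a j 1) * X ^ (e + 1) + C (a j 2) * X ^ (e + k + 2)) := by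
    intro j
    rw [Fin.sum_univ_three, he, hk]
    ring
  have hmem : (C c * X ^ (m * d l₀) + ∏ j, ∑ l, C (a j l) * X ^ (d l) : ℝ[X])
      = X ^ (m * d 0) * (C c * X ^ (m * N)
          + ∏ j, (C (a j 0) + C (a j 1) * X ^ (e + 1) + C (a j 2) * X ^ (e + k + 2))) := by
    rw [Finset.prod_congr rfl (fun j _ => hfac j), Finset.prod_mul_distrib, Finset.prod_const, Finset.card_univ,
      Fintype.card_fin, ← pow_mul, mul_comm (d 0) m, hN, Nat.mul_add, pow_add]
    ring
  rw [hmem]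
  by_cases h0 : (X ^ (m * d 0) * (C c * X ^ (m * N)
      + ∏ j, (C (a j 0) + C (a j 1) * X ^ (e + 1) + C (a j 2) * X ^ (e + k + 2))) : ℝ[X]) = 0
  · rw [h0, roots_zero, Multiset.toFinset_zero, Finset.filter_empty, Finset.card_empty]
    exact Nat.zero_le _
  · rw [roots_mul h0, roots_pow, roots_X, Multiset.toFinset_add, Finset.filter_union]
    refine (Finset.card_union_le _ _).trans ?_
    have hz : (((m * d 0) • ({0} : Multiset ℝ)).toFinset.filter (fun t => 0 < t)) = ∅ := by
      rw [Finset.filter_eq_empty_iff]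
      intro t ht
      rw [Multiset.mem_toFinset] at ht
      have h00 := Multiset.mem_singleton.mp (Multiset.mem_of_mem_nsmul ht)
      rw [h00]
      exact lt_irrefl 0
    rw [hz, Finset.card_empty, zero_add]
    have hwit' : ∀ j, ∃ x₀ : ℝ, 0 < x₀ ∧ a j 0 + a j 1 * x₀ ^ (e + 1) + a j 2 * x₀ ^ (e + k + 2) < 0 := by
      intro j
      obtain ⟨x₀, hx₀, hneg⟩ := hwit j
      refine ⟨x₀, hx₀, ?_⟩
      have hxd : 0 < x₀ ^ (d 0) := pow_pos hx₀ _
      have e1 : a j 0 * x₀ ^ (d 0) + a j 1 * x₀ ^ (d 1) + a j 2 * x₀ ^ (d 2)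
          = x₀ ^ (d 0) * (a j 0 + a j 1 * x₀ ^ (e + 1) + a j 2 * x₀ ^ (e + k + 2)) := by
        rw [he, hk]; ring
      rw [e1] at hneg
      by_contra hcon
      push Not at hcon
      exact absurd hneg (not_lt.mpr (mul_nonneg hxd.le hcon))
    exact sharp_sector_pos_roots (fun j => a j 0) (fun j => a j 1) (fun j => a j 2) e k hpos hwit' (m * N) c

end ProductPlusOne

end Summit.ValiantsHypothesis.ValiantsHypothesis.Theorems.LacunarySymmetroidMatrixDescartes
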